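import Literature.MathematicalPhysics.QuantumFieldTheory.Balaban1983to89.B9Conv348OfRegYP335AtLettersY

/-!
# `Balaban1983to89.B9Thm311EigenBoundOfMajorant` — T. Bałaban, *Propagators for lattice gauge theories in a background field*, Commun. Math. Phys. **99**
# (1985) 389–434 [Balaban1985BackgroundPropagators], Thm 3.3 (3.42) p. 397 with [4] = [Balaban1984PropagatorsII] (2.51)–(2.52) p. 232, Lemma 2.1
# (2.60)–(2.61) p. 234: A [4]-(2.51) BLOCK MAJORANT BOUNDS EVERY REAL EIGENVALUE (row-sum bound ⇒ `|μ| ≤ max_a Σ_{a′} K(a,a′)`), diagonal (scale-weight)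
# sandwiches of majorants, and the row sum of the weighted profile `ℓ(a)ℓ(a′)⁻¹e^{−δd(a,a′)}` — FILE C of the row-17 road (cell `pub-ymgap`, seat `dag-n06-j` gen 31)

statement-level skeleton of published theorems with citation tags; proofs where landed; nothing here is a claim about the Yang–Mills mass gap

THE PRINT.  Thm 3.3 p. 399 ∕ (3.42) p. 397 (the block decay of `G = Δ_a⁻¹`, prefactor `(Lʲη)²`); [4] (2.51) p. 232 («|(Tλ)(x)| ≦ K(y, y′)|λ|»), (2.52)
(composition), Lemma 2.1 (2.60)–(2.61) p. 234 (scale transfer along the block distance, row sums); p. 398 remark after (3.47) («we may replace the factor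
(Lʲη)^α by (Lʲη)^β(L^{j′}η)^γ»).

WHY THIS FILE.  Row 17's road (this seat's INTENT-4): Theorem 3.3's (3.42) block for `G = Δ_a⁻¹` (cell lit-balaban's ASM2 through `isUnit_deltaAY_and_eBlock_of_regYP335_section`,
read into a [4]-(2.51) majorant of `conj b G` by p33's `hasMajorant_conj_G_of_eBlockInvB`) must bound the spectrum of the SCALE-WEIGHTED `G`: the weighted
operator `M_{ℓ⁻¹}GM_{ℓ⁻¹}` (`ℓ(b) = L^{j(b)}η`) has the majorant `C·ℓ(a)ℓ(a′)⁻¹e^{−δd(a,a′)}`, whose row sums are `≤ C·L·c₁` by (2.60)∕(2.61); and a block majorant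
with row sums `≤ R` bounds every real eigenvalue by `R` (evaluate the eigen-equation at a maximal coordinate).  THIS FILE supplies these three generic steps.

WHAT IS PROVED (sorry-free; 0 `def`; linear algebra ∕ bookkeeping).
* §1 ★ `abs_eigen_le_of_hasMajorant_rowSum` — `HasMajorant blk T K`, `Σ_{y′} K(a,y′) ≤ R` for all `a` ⟹ every real eigenvalue `μ` of `T` (`Tc = μc`, `c ≠ 0`)
  has `|μ| ≤ R` ([4] (2.51): decompose `c` into its block pieces, evaluate at a coordinate of maximal modulus).
* §2 ★ `hasMajorant_mulOp_sandwich` — `HasMajorant blk T K` and `|ρ(x)| ≤ c(blk x)` ⟹ `HasMajorant blk (M_ρ·T·M_ρ) (c(a)K(a,a′)c(a′))` ((2.52) with diagonal factors;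
  the one-sided forms are the tree's `B6CommutatorZoneKernels.hasMajorant_diag_mul` ∕ n06-j g15 `hasMajorant_mul_diag` with CONSTANT diagonals).
* §3 the coordinates: `conj_cutMulY_restrict_eq_mulOp` (lit-balaban's `conj b` of the tree's multiplication letter `cutMulY r` IS `mulOp (r ∘ fst)`),
  ★ `abs_eigen_le_of_conj_hasMajorant` (a majorant of `conj b G` with row sums `≤ R` bounds every real eigenvalue of the genuine `ℝ`-linear `G` by `R`).
* §4 ★ `rowSum_lenRatio_le` — under (2.60) in p33's `TransferL` form at `q = 1` (`ℓ(a) ≤ A·e^{εd}·ℓ(a′)`) and a row-sum bound `Σ e^{−κ d} ≤ C` with `κ ≤ δ − ε`: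
  `Σ_{a′} ℓ(a)ℓ(a′)⁻¹e^{−δd(a,a′)} ≤ A·C` (any `B9.Geometry` with non-negative symmetric distance and positive lengths).
HONEST SCOPE.  Generic finite-dimensional bookkeeping; nothing of [B9] asserted; NOT a node discharge; count-neutral; nothing continuum ∕ OS ∕ mass gap ∕ Clay.
Cell `pub-ymgap` (HUMAN RULING D-0062), node N06 [B9], seat `pub-ymgap-dag-n06-j` (harness re-seat gen 31), 2026-08-29.  No `sorry`, no `axiom`, no
`instance`, no `notation`, no `def`.  NEW file.  RELATED: the primed private `hasMajorant_mulOp_sandwich'` of `B9Cor36CinvCubeLocDefectTransfer` (p33; private,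
not importable — same idea).
-/

noncomputable section

namespace Literature.MathematicalPhysics.QuantumFieldTheory.Balaban1983to89.B9Thm311EigenBoundOfMajorant

open Literature.MathematicalPhysics.QuantumFieldTheory.Balaban1983to89
open B6RandomWalk
open Literature.MathematicalPhysics.QuantumFieldTheory.Balaban1983to89.B9Thm37Sum (mulOp mulOp_apply)
open Literature.MathematicalPhysics.QuantumFieldTheory.Balaban1983to89.B9Thm37CubeCoverCommutators (cutMulY cutMulY_apply)
open Literature.MathematicalPhysics.QuantumFieldTheory.Balaban1983to89.B9Eq352DivFormLetters (conj conj_apply coordEquiv coordEquiv_apply)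
open Literature.MathematicalPhysics.QuantumFieldTheory.Balaban1983to89.B6Cor28 (TransferL)

/-! ## §1 A block majorant with bounded row sums bounds every real eigenvalue -/

section Eigen

variable {g : B6.Geometry} {X : Type} [Fintype X]

/-- ★ **[4] (2.51) BOUNDS THE SPECTRUM**: if `T` has the block majorant `K` w.r.t. `blk` and every row sum `Σ_{y′} K(a, y′) ≤ R`, then every real eigenvalue
`μ` of `T` satisfies `|μ| ≤ R`. [cite: Balaban1984PropagatorsII, (2.51) p.232, bookkeeping] -/
theorem abs_eigen_le_of_hasMajorant_rowSum (blk : X → g.Site) {T : Module.End ℝ (X → ℝ)} {K : g.Site → g.Site → ℝ} (hT : HasMajorant blk T K)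
    {R : ℝ} (hrow : ∀ a, ∑ y', K a y' ≤ R) {μ : ℝ} {c : X → ℝ} (hc : c ≠ 0) (h : T c = μ • c) : |μ| ≤ R := by
  classical
  -- a coordinate of maximal modulus
  have hne : Nonempty X := by
    by_contra hX
    apply hc; funext x; exact absurd ⟨x⟩ hX
  obtain ⟨x₀, hx₀⟩ := Finite.exists_max fun x => |c x|
  set B := |c x₀| with hB
  have hB0 : 0 < B := by
    by_contra hle
    push Not at hle
    apply hc; funext x
    have := (hx₀ x).trans hle
    exact abs_nonpos_iff.1 this
  -- decompose `c` into block pieces and evaluate `Tc` at `x₀`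
  have hdec : T c x₀ = ∑ y', T (blockPiece blk y' c) x₀ := by
    conv_lhs => rw [← sum_blockPiece blk c]
    rw [map_sum, Finset.sum_apply]
  have hpiece : ∀ y', |T (blockPiece blk y' c) x₀| ≤ K (blk x₀) y' * B :=
    fun y' => hT y' _ B (blockSupp_blockPiece blk c y' B hB0.le fun x _ => hx₀ x) x₀
  have hsum : |T c x₀| ≤ (∑ y', K (blk x₀) y') * B := by
    rw [hdec, Finset.sum_mul]
    exact (Finset.abs_sum_le_sum_abs _ _).trans (Finset.sum_le_sum fun y' _ => hpiece y')
  have hμ : |T c x₀| = |μ| * B := by rw [h, Pi.smul_apply, smul_eq_mul, abs_mul]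
  rw [hμ] at hsum
  have := (le_of_mul_le_mul_right (hsum.trans (mul_le_mul_of_nonneg_right (hrow _) hB0.le)) hB0)
  exact this

end Eigen

/-! ## §2 (2.52) with diagonal factors: the scale-weight sandwich of a majorant -/

section Sandwich

variable {g : B6.Geometry} {X : Type}

/-- ★ **DIAGONAL SANDWICH**: if `T` has the majorant `K` and `|ρ(x)| ≤ c(blk x)` with `c ≥ 0`, then `M_ρ·T·M_ρ` has the majorant `c(a)·K(a,a′)·c(a′)`.
[cite: Balaban1984PropagatorsII, (2.52) p.232 (composition of majorants), bookkeeping] -/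
theorem hasMajorant_mulOp_sandwich (blk : X → g.Site) {T : Module.End ℝ (X → ℝ)} {K : g.Site → g.Site → ℝ} (hT : HasMajorant blk T K)
    {ρ : X → ℝ} {c : g.Site → ℝ} (hc : ∀ a, 0 ≤ c a) (hρ : ∀ x, |ρ x| ≤ c (blk x)) :
    HasMajorant blk (mulOp ρ * T * mulOp ρ) (fun a a' => c a * K a a' * c a') := by
  intro y' μ B hμ x
  have hμ' : BlockSupp blk (mulOp ρ μ) y' (c y' * B) := by
    refine ⟨mul_nonneg (hc y') hμ.nonneg, fun z hz => ?_, fun z hz => ?_⟩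
    · rw [mulOp_apply, abs_mul]
      have h1 := hρ z; rw [hz] at h1
      exact mul_le_mul h1 (hμ.bound z hz) (abs_nonneg _) (hc y')
    · rw [mulOp_apply, hμ.off z hz, mul_zero]
  have hTx := hT y' _ _ hμ' x
  rw [Module.End.mul_apply, Module.End.mul_apply, mulOp_apply, abs_mul]
  have hK0 : 0 ≤ K (blk x) y' * (c y' * B) := (abs_nonneg _).trans hTx
  calc |ρ x| * |T (mulOp ρ μ) x| ≤ c (blk x) * (K (blk x) y' * (c y' * B)) := mul_le_mul (hρ x) hTx (abs_nonneg _) (hc _)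
    _ = c (blk x) * K (blk x) y' * c y' * B := by ring

end Sandwich

/-! ## §3 Coordinates: `conj b (cutMulY r) = mulOp (r ∘ fst)`; eigenvalues of the genuine operator -/

section Coords

open scoped Matrix.Norms.L2Operator

variable {S : Type} {N : ℕ} {ι : Type} [Fintype ι] (b : Module.Basis ι ℝ (Matrix (Fin N) (Fin N) ℂ))

/-- lit-balaban's real-coordinate conjugate of the tree's multiplication letter `M_r = cutMulY r` IS the diagonal `mulOp (r ∘ fst)`.
[cite: Balaban1984PropagatorsII, (2.51) p.232 (the real-coordinate carrier), dictionary] -/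
theorem conj_cutMulY_restrict_eq_mulOp (r : S → ℝ) :
    conj b ((cutMulY (𝔸 := Matrix (Fin N) (Fin N) ℂ) r).restrictScalars ℝ) = mulOp (fun p : S × ι => r p.1) := by
  apply LinearMap.ext; intro μ; funext p
  rw [conj_apply, LinearMap.restrictScalars_apply, cutMulY_apply, mulOp_apply, Complex.coe_smul, map_smul, Finsupp.smul_apply, smul_eq_mul]
  congr 1
  have := congrArg (fun f => f p) ((coordEquiv b).apply_symm_apply μ)
  rw [coordEquiv_apply] at this
  exact this

/-- ★ a [4]-(2.51) majorant of `conj b G` with row sums `≤ R` bounds every REAL eigenvalue of the genuine `ℝ`-linear operator `G` on `S → M_N(ℂ)` by `R`.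
[cite: Balaban1984PropagatorsII, (2.51) p.232, bookkeeping] -/
theorem abs_eigen_le_of_conj_hasMajorant [Fintype S] {g : B6.Geometry} (blk : S × ι → g.Site)
    (G : Module.End ℝ (S → Matrix (Fin N) (Fin N) ℂ)) {K : g.Site → g.Site → ℝ} (hK : HasMajorant blk (conj b G) K)
    {R : ℝ} (hrow : ∀ a, ∑ y', K a y' ≤ R) {μ : ℝ} {Φ : S → Matrix (Fin N) (Fin N) ℂ} (hΦ : Φ ≠ 0) (h : G Φ = μ • Φ) : |μ| ≤ R := by
  have hc : coordEquiv b Φ ≠ 0 := fun h0 => hΦ ((coordEquiv b).map_eq_zero_iff.1 h0)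
  refine abs_eigen_le_of_hasMajorant_rowSum blk hK hrow hc ?_
  apply funext; intro p
  rw [conj_apply, LinearEquiv.symm_apply_apply, h, ← coordEquiv_apply, LinearEquiv.map_smul]

end Coords

/-! ## §4 The row sum of the weighted profile `ℓ(a)·ℓ(a′)⁻¹·e^{−δd(a,a′)}` from (2.60) + (2.61) -/

section RowSum

variable {g : B9.Geometry} [Fintype g.Site]

/-- ★ **ROW SUM OF THE SCALE-WEIGHTED PROFILE**: if `ℓ(a) ≤ A·e^{εd(a′,a)}·ℓ(a′)` for all `a, a′` ((2.60), `TransferL` at `q = 1`), the distance is symmetric,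
lengths are positive, and `Σ_{a′} e^{−κd(a,a′)} ≤ C` with `κ ≤ δ − ε`, then `Σ_{a′} B·ℓ(a)·ℓ(a′)⁻¹·e^{−δd(a,a′)} ≤ B·A·C` (`A, B, C ≥ 0`).
[cite: Balaban1984PropagatorsII, Lemma 2.1 (2.60)–(2.61) p.234; Balaban1985BackgroundPropagators, p.398 (remark after (3.47))] -/
theorem rowSum_lenRatio_le {ε δ κ A B C : ℝ} (hA : 0 ≤ A) (hB : 0 ≤ B) (hκ : κ ≤ δ - ε)
    (hlen : ∀ a, 0 < g.len a) (hdist0 : ∀ a a', 0 ≤ g.dist a a') (hdistc : ∀ a a', g.dist a a' = g.dist a' a)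
    (htr : TransferL g.len g.dist ε 1 A) (hrow : ∀ a, ∑ a', Real.exp (-(κ * g.dist a a')) ≤ C) (a : g.Site) :
    ∑ a', B * g.len a * (g.len a')⁻¹ * Real.exp (-(δ * g.dist a a')) ≤ B * A * C := by
  have hterm : ∀ a', B * g.len a * (g.len a')⁻¹ * Real.exp (-(δ * g.dist a a')) ≤ B * A * Real.exp (-(κ * g.dist a a')) := by
    intro a'
    have h1 := htr a' a
    simp only [Real.rpow_one] at h1
    rw [hdistc a' a] at h1
    -- `ℓ(a)/ℓ(a′) ≤ A e^{εd}`
    have h2 : g.len a * (g.len a')⁻¹ ≤ A * Real.exp (ε * g.dist a a') := by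
      rw [← div_eq_mul_inv, div_le_iff₀ (hlen a')]
      exact h1
    have hd := hdist0 a a'
    have h3 : Real.exp (ε * g.dist a a') * Real.exp (-(δ * g.dist a a')) ≤ Real.exp (-(κ * g.dist a a')) := by
      rw [← Real.exp_add]
      exact Real.exp_le_exp.2 (by nlinarith)
    calc B * g.len a * (g.len a')⁻¹ * Real.exp (-(δ * g.dist a a'))
        = B * (g.len a * (g.len a')⁻¹) * Real.exp (-(δ * g.dist a a')) := by ring
      _ ≤ B * (A * Real.exp (ε * g.dist a a')) * Real.exp (-(δ * g.dist a a')) :=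
          mul_le_mul_of_nonneg_right (mul_le_mul_of_nonneg_left h2 hB) (Real.exp_pos _).le
      _ = B * A * (Real.exp (ε * g.dist a a') * Real.exp (-(δ * g.dist a a'))) := by ring
      _ ≤ B * A * Real.exp (-(κ * g.dist a a')) := mul_le_mul_of_nonneg_left h3 (mul_nonneg hB hA)
  calc ∑ a', B * g.len a * (g.len a')⁻¹ * Real.exp (-(δ * g.dist a a'))
      ≤ ∑ a', B * A * Real.exp (-(κ * g.dist a a')) := Finset.sum_le_sum fun a' _ => hterm a'
    _ = B * A * ∑ a', Real.exp (-(κ * g.dist a a')) := by rw [Finset.mul_sum]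
    _ ≤ B * A * C := mul_le_mul_of_nonneg_left (hrow a) (mul_nonneg hB hA)

end RowSum

end Literature.MathematicalPhysics.QuantumFieldTheory.Balaban1983to89.B9Thm311EigenBoundOfMajorant

end
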